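import Summits.RiemannHypothesis.RiemannHypothesis.Theorems.WeilBochnerMeasureGrowth
import Mathlib.Analysis.SpecificLimits.Normed
import HarnessLib

/-!
# RiemannHypothesis — tail of a representing measure: `∫_{|t|>T} t⁻² dμ = O((1 + log T)/T)`

Helper file (`--supports stmt-RiemannHypothesis-0098`), RH-free, standard axioms.  Seat rh-explicit
weil-3 (structure).  From the upper growth law `μ[-R, R] ≤ R(A + 8 log R)/cos²1` (`measure_Icc_le`) on
the dyadic shells `[T2^j, T2^{j+1}]`:

  `∫_{|t|>T} t⁻² dμ(t) ≤ (2/(T cos²1)) · (2A + 16 log T + 32 log 2)`   (`lintegral_sq_inv_compl_le`),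

the tail estimate used by the lower growth law (`WeilBochnerMeasureDensity.lean`).
-/

noncomputable section

set_option linter.dupNamespace false  -- the mandated namespace repeats `RiemannHypothesis`

open Complex Filter Set MeasureTheory
open scoped Real Topology

namespace Summit.RiemannHypothesis.RiemannHypothesis.Theorems.WeilBochnerMeasure

variable {μ : Measure ℝ}

/-! ## The tail `∫_{|t| > T} t⁻² dμ = O((1 + log T)/T)` from the upper growth law -/

/-- Dyadic shell bound above height `T > 0`: for `|t| > T`,
`t⁻² ≤ Σ_j (T 2^j)⁻² 𝟙_{[-T 2^{j+1}, T 2^{j+1}]}(t)` (in `ℝ≥0∞`). -/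
theorem ofReal_sq_inv_le_shells {T : ℝ} (hT : 0 < T) {t : ℝ} (ht : T < |t|) :
    ENNReal.ofReal ((t ^ 2)⁻¹) ≤ ∑' j : ℕ, ENNReal.ofReal (((T * 2 ^ j) ^ 2)⁻¹) *
      (Icc (-(T * 2 ^ (j + 1))) (T * 2 ^ (j + 1))).indicator (fun _ ↦ (1 : ENNReal)) t := by
  have hex : ∃ j : ℕ, |t| ≤ T * 2 ^ (j + 1) := by
    obtain ⟨j, hj⟩ := pow_unbounded_of_one_lt (|t| / T) (by norm_num : (1 : ℝ) < 2)
    refine ⟨j, ?_⟩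
    rw [div_lt_iff₀ hT] at hj
    calc |t| ≤ 2 ^ j * T := hj.le
      _ ≤ T * 2 ^ (j + 1) := by rw [pow_succ, mul_comm]; nlinarith [pow_pos (two_pos : (0:ℝ) < 2) j]
  classical
  set j := Nat.find hex with hj
  have hj1 : |t| ≤ T * 2 ^ (j + 1) := Nat.find_spec hex
  have hj2 : T * 2 ^ j < |t| := by
    rcases Nat.eq_zero_or_pos j with h0 | hpos
    · rw [h0, pow_zero, mul_one]; exact ht
    · have hmin := Nat.find_min hex (m := j - 1) (by omega)
      rw [not_le] at hmin
      have e : j - 1 + 1 = j := by omega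
      rwa [e] at hmin
  have hmem : t ∈ Icc (-(T * 2 ^ (j + 1))) (T * 2 ^ (j + 1)) := by
    rw [mem_Icc, ← abs_le]; exact hj1
  calc ENNReal.ofReal ((t ^ 2)⁻¹) ≤ ENNReal.ofReal (((T * 2 ^ j) ^ 2)⁻¹) := by
        refine ENNReal.ofReal_le_ofReal (inv_anti₀ (by positivity) ?_)
        have : (T * 2 ^ j) ^ 2 < |t| ^ 2 := by gcongr
        rw [sq_abs] at this
        exact this.le
    _ = ENNReal.ofReal (((T * 2 ^ j) ^ 2)⁻¹) *
          (Icc (-(T * 2 ^ (j + 1))) (T * 2 ^ (j + 1))).indicator (fun _ ↦ (1 : ENNReal)) t := by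
        rw [indicator_of_mem hmem, mul_one]
    _ ≤ _ := ENNReal.le_tsum j

/-- **Tail bound.**  If `μ[-R, R] ≤ R (A + 8 log R)/cos²1` for all `R ≥ T` (`T ≥ 1`, `A ≥ 0`), then
`∫_{|t|>T} t⁻² dμ ≤ (2/(T cos²1)) · (2A + 16 log T + 32 log 2)`. -/
theorem lintegral_sq_inv_compl_le {T A : ℝ} (hT : 1 ≤ T) (hA : 0 ≤ A)
    (hμA : ∀ R : ℝ, T ≤ R → μ (Icc (-R) R) ≤ ENNReal.ofReal (R * (A + 8 * Real.log R) / Real.cos 1 ^ 2)) :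
    ∫⁻ t in (Icc (-T) T)ᶜ, ENNReal.ofReal ((t ^ 2)⁻¹) ∂μ ≤
      ENNReal.ofReal (2 / (T * Real.cos 1 ^ 2) * (2 * A + 16 * Real.log T + 32 * Real.log 2)) := by
  have hT0 : 0 < T := by linarith
  have hlogT : 0 ≤ Real.log T := Real.log_nonneg hT
  have hlog2 : 0 < Real.log 2 := Real.log_pos one_lt_two
  have hcos : 0 < Real.cos 1 := Real.cos_pos_of_mem_Ioo ⟨by linarith [Real.pi_gt_three],
    by linarith [Real.pi_gt_three]⟩
  set R : ℕ → ℝ := fun j ↦ T * 2 ^ (j + 1) with hR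
  have hRge : ∀ j, T ≤ R j := fun j ↦ by
    rw [hR]; exact le_mul_of_one_le_right hT0.le (one_le_pow₀ (by norm_num))
  -- the real series
  set a : ℕ → ℝ := fun j ↦ ((T * 2 ^ j) ^ 2)⁻¹ * (R j * (A + 8 * Real.log (R j)) / Real.cos 1 ^ 2) with ha
  have hlogR : ∀ j : ℕ, Real.log (R j) = Real.log T + (j + 1) * Real.log 2 := fun j ↦ by
    rw [hR]; simp only
    rw [Real.log_mul hT0.ne' (by positivity), Real.log_pow]; push_cast; ring
  have ha_eq : ∀ j : ℕ, a j = 2 / (T * Real.cos 1 ^ 2) *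
      ((A + 8 * Real.log T + 8 * Real.log 2) * (1 / 2) ^ j + 8 * Real.log 2 * ((j : ℝ) * (1 / 2) ^ j)) := by
    intro j
    simp only [ha]
    rw [hlogR]
    simp only [hR]
    have h2 : (2 : ℝ) ^ j ≠ 0 := pow_ne_zero _ two_ne_zero
    rw [show ((1 : ℝ) / 2) ^ j = (2 ^ j)⁻¹ by rw [one_div, inv_pow], pow_succ]
    field_simp
    ring
  have ha0 : ∀ j, 0 ≤ a j := fun j ↦ by
    simp only [ha, hR]
    refine mul_nonneg (by positivity) (div_nonneg (mul_nonneg (by positivity) ?_) (by positivity))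
    rw [hlogR]; positivity
  have h1 : HasSum (fun j : ℕ ↦ (1 / 2 : ℝ) ^ j) 2 := hasSum_geometric_two
  have h2 : HasSum (fun j : ℕ ↦ (j : ℝ) * (1 / 2 : ℝ) ^ j) 2 := by
    have h := hasSum_coe_mul_geometric_of_norm_lt_one (𝕜 := ℝ) (r := 1 / 2)
      (by rw [Real.norm_eq_abs, abs_of_pos (by norm_num)]; norm_num)
    norm_num at h
    exact h
  have hsum : HasSum a (2 / (T * Real.cos 1 ^ 2) * ((A + 8 * Real.log T + 8 * Real.log 2) * 2 +
      8 * Real.log 2 * 2)) := by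
    have e : a = fun j : ℕ ↦ 2 / (T * Real.cos 1 ^ 2) *
        ((A + 8 * Real.log T + 8 * Real.log 2) * (1 / 2) ^ j + 8 * Real.log 2 * ((j : ℝ) * (1 / 2) ^ j)) :=
      funext ha_eq
    rw [e]
    exact ((h1.mul_left _).add (h2.mul_left _)).mul_left _
  have htsum : ∑' j, a j = 2 / (T * Real.cos 1 ^ 2) * (2 * A + 16 * Real.log T + 32 * Real.log 2) := by
    rw [hsum.tsum_eq]; ring
  -- shells
  have hmeas : ∀ j : ℕ, Measurable fun t : ℝ ↦ ENNReal.ofReal (((T * 2 ^ j) ^ 2)⁻¹) *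
      (Icc (-(T * 2 ^ (j + 1))) (T * 2 ^ (j + 1))).indicator (fun _ ↦ (1 : ENNReal)) t := fun j ↦
    (measurable_const.indicator measurableSet_Icc).const_mul _
  calc ∫⁻ t in (Icc (-T) T)ᶜ, ENNReal.ofReal ((t ^ 2)⁻¹) ∂μ
      ≤ ∫⁻ t in (Icc (-T) T)ᶜ, ∑' j : ℕ, ENNReal.ofReal (((T * 2 ^ j) ^ 2)⁻¹) *
          (Icc (-(T * 2 ^ (j + 1))) (T * 2 ^ (j + 1))).indicator (fun _ ↦ (1 : ENNReal)) t ∂μ := by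
        refine setLIntegral_mono' (measurableSet_Icc.compl) fun t ht ↦ ofReal_sq_inv_le_shells hT0 ?_
        rw [mem_compl_iff, mem_Icc, ← abs_le, not_le] at ht
        exact ht
    _ ≤ ∫⁻ t, ∑' j : ℕ, ENNReal.ofReal (((T * 2 ^ j) ^ 2)⁻¹) *
          (Icc (-(T * 2 ^ (j + 1))) (T * 2 ^ (j + 1))).indicator (fun _ ↦ (1 : ENNReal)) t ∂μ :=
        setLIntegral_le_lintegral _ _
    _ = ∑' j : ℕ, ENNReal.ofReal (((T * 2 ^ j) ^ 2)⁻¹) * μ (Icc (-R j) (R j)) := by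
        rw [lintegral_tsum fun j ↦ (hmeas j).aemeasurable]
        refine tsum_congr fun j ↦ ?_
        rw [lintegral_const_mul _ (measurable_const.indicator measurableSet_Icc),
          lintegral_indicator_const measurableSet_Icc, one_mul]
    _ ≤ ∑' j : ℕ, ENNReal.ofReal (a j) := by
        gcongr with j
        simp only [ha]
        rw [ENNReal.ofReal_mul (by positivity)]
        gcongr
        exact hμA (R j) (hRge j)
    _ = ENNReal.ofReal (∑' j, a j) := (ENNReal.ofReal_tsum_of_nonneg ha0 hsum.summable).symm
    _ = _ := by rw [htsum]

end Summit.RiemannHypothesis.RiemannHypothesis.Theorems.WeilBochnerMeasure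

end
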